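import Mathlib.RepresentationTheory.Continuous.TopRep
import Mathlib.Topology.CompactOpen
import Mathlib.Topology.Algebra.ContinuousMonoidHom
import Literature.NumberTheory.GaloisRepresentations.ContinuousRep
import Literature.NumberTheory.GaloisRepresentations.CohomologicalDimension
import HarnessLib

/-!
# The coinduced (induced) module `M_G^S(A)` of a discrete `S`-module (Serre I §2.5)

For a closed subgroup `S` of a profinite group `G` and a discrete `S`-module `A`, Serre
(*Cohomologie galoisienne*, I §2.5) defines the *induced module*
`A* = M_G^S(A) := {a* : G → A continuous | a*(s x) = s · a*(x), s ∈ S, x ∈ G}` with `G`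
acting by `(g a*)(x) = a*(x g)`, and the map "valeur au point `1`" `M_G^S(A) → A`, compatible with
`S ↪ G`, inducing `H^q(G, M_G^S(A)) → H^q(S, A)` (isomorphisms: Prop. 10, Faddeev–Shapiro).

Mathlib already has the carrier and the action as `ContRepresentation.coindV` /
`ContRepresentation.coind` (for any continuous homomorphism `S → G`; here the inclusion
`subgroupIncl S : S →ₜ* G`).  This file supplies what `GroupCdLE`
(`CohomologicalDimension.lean`) needs in order to *apply* `cd_p(G) ≤ n` to `M_G^S(A)`:

* `discreteTopology_continuousMap`: `C(G, A)` (compact-open) is **discrete** for `G` compact and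
  `A` discrete, hence so is `M_G^S(A) ⊆ C(G, A)`;
* `coindRep σ : ContinuousRep G ℤ (M_G^S(A))`: the action is **jointly continuous** (Serre: `A*`
  "est un `G`-module discret");
* `isPrimaryTorsion_coind`: `M_G^S(A)` is `p`-primary torsion when `A` is (a continuous map on a
  compact space into a discrete group has finite image; Serre: "de torsion");
* `coindEvalOne σ : res (S ↪ G) (M_G^S(A)) ⟶ A`, `a* ↦ a*(1)`, the `S`-equivariant continuous
  map of §2.5 inducing the Shapiro map `H^q(G, M_G^S(A)) → H^q(S, A)`
  (`ContinuousCohomology.map (subgroupIncl S) (coindEvalOne σ) q`).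

The Shapiro retraction itself is in `CohomologicalDimensionProofs.lean`.

## References

* J.-P. Serre, *Cohomologie galoisienne* / *Galois Cohomology* (1997), I §2.5 (modules induits,
  Prop. 10). [SerreGaloisCohomology1997]
-/

noncomputable section

namespace Literature.NumberTheory.GaloisRepresentations

open ContRepresentation ContinuousMap Set

universe u

/-! ### `C(G, A)` is discrete for `G` compact and `A` discrete -/

/-- For a compact space `G` and a discrete space `A`, the compact-open topology on `C(G, A)` is
discrete: `{f} = ⋂_{a ∈ f(G)} {g | g(f⁻¹(a)) ⊆ {a}}` is a finite intersection of basic open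
sets. [folklore] -/
theorem discreteTopology_continuousMap (G A : Type*) [TopologicalSpace G] [CompactSpace G]
    [TopologicalSpace A] [DiscreteTopology A] : DiscreteTopology C(G, A) := by
  rw [discreteTopology_iff_isOpen_singleton]
  intro f
  have hfin : (range f).Finite := (isCompact_range f.continuous).finite_of_discrete
  have key : ({f} : Set C(G, A)) =
      ⋂ a ∈ range f, {g : C(G, A) | MapsTo g (f ⁻¹' {a}) {a}} := by
    ext g
    simp only [mem_singleton_iff, mem_iInter, mem_setOf_eq]
    constructor
    · rintro rfl a _ x hx
      exact hx
    · intro h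
      ext x
      exact h (f x) (mem_range_self x) rfl
  rw [key]
  exact hfin.isOpen_biInter fun a _ =>
    ContinuousMap.isOpen_setOf_mapsTo ((isClosed_discrete _).preimage f.continuous).isCompact
      (isOpen_discrete _)

/-! ### The coinduced module as a discrete `G`-module -/

section Coind

variable {G : Type u} [Group G] [TopologicalSpace G]

/-- The inclusion of a subgroup as a continuous group homomorphism `S →ₜ* G`. [folklore] -/
def subgroupIncl (S : Subgroup G) : S →ₜ* G := ⟨S.subtype, continuous_subtype_val⟩

/-- `subgroupIncl S s = s`. [folklore] -/
@[simp] theorem subgroupIncl_apply (S : Subgroup G) (s : S) : subgroupIncl S s = s := rfl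

/-- The underlying monoid hom of `subgroupIncl S` is `S.subtype`. [folklore] -/
theorem coe_subgroupIncl (S : Subgroup G) : (subgroupIncl S : S →* G) = S.subtype := rfl

variable {S : Subgroup G} {A : Type u} [AddCommGroup A] [TopologicalSpace A]
  [IsTopologicalAddGroup A] (σ : ContinuousRep S ℤ A)

/-- The carrier of Serre's induced module `M_G^S(A)`: continuous `a* : G → A` with
`a*(s x) = s · a*(x)` (Mathlib `ContRepresentation.coindV` for the inclusion `S →ₜ* G`), a
`ℤ`-submodule of `C(G, A)` with the subspace (compact-open) topology.
[cite: SerreGaloisCohomology1997, I §2.5] -/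
abbrev coindModule : Submodule ℤ C(G, A) := σ.toContRepresentation.coindV (subgroupIncl S)

/-- Membership in `M_G^S(A)`: `a*(s x) = s · a*(x)`. [cite: SerreGaloisCohomology1997, I §2.5] -/
theorem mem_coind_iff (f : C(G, A)) :
    f ∈ coindModule σ ↔ ∀ (s : S) (x : G), f (s * x) = σ s (f x) :=
  Iff.rfl

/-- `M_G^S(A)` is discrete for `G` compact and `A` discrete (a subspace of the discrete space
`C(G, A)`). [folklore] -/
theorem discreteTopology_coind [CompactSpace G] [DiscreteTopology A] :
    DiscreteTopology (coindModule σ) :=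
  haveI : DiscreteTopology C(G, A) := discreteTopology_continuousMap G A
  inferInstance

/-- `M_G^S(A)` is `p`-primary torsion when `A` is and `G` is compact: `a*(G)` is finite, so one
power of `p` kills all values (Serre I §3.3, proof of Prop. 14: "`M_G^H(A)` est un `G`-module
discret de torsion"). [cite: SerreGaloisCohomology1997, I §3.3 (proof of Prop. 14)] -/
theorem isPrimaryTorsion_coind [CompactSpace G] [DiscreteTopology A] {p : ℕ}
    (hA : IsPrimaryTorsion p A) : IsPrimaryTorsion p (coindModule σ) := by
  intro f
  have hfin : (range (f : C(G, A))).Finite :=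
    (isCompact_range (f : C(G, A)).continuous).finite_of_discrete
  choose r hr using hA
  refine ⟨hfin.toFinset.sup r, Subtype.ext ?_⟩
  rw [Submodule.coe_smul_of_tower, Submodule.coe_zero]
  ext x
  have hx : (f : C(G, A)) x ∈ hfin.toFinset := by simp
  obtain ⟨k, hk⟩ := Nat.exists_eq_add_of_le (Finset.le_sup (f := r) hx)
  rw [ContinuousMap.coe_smul, Pi.smul_apply, hk, pow_add, mul_comm, mul_smul, hr,
    smul_zero, ContinuousMap.zero_apply]

variable [IsTopologicalGroup G]

/-- **The induced module `M_G^S(A)` as a continuous representation of `G`** on a discrete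
abelian group: `(g a*)(x) = a*(x g)` (Mathlib `ContRepresentation.coind`), jointly continuous for
`G` compact and `A` discrete because `M_G^S(A)` is then discrete and each orbit map
`g ↦ a* ∘ (· g)` is continuous (curried multiplication). Serre I §2.5: "Le groupe `G` opère
sur `A*` par la formule `(g a*)(x) = a*(xg)`". [cite: SerreGaloisCohomology1997, I §2.5] -/
def coindRep [CompactSpace G] [DiscreteTopology A] : ContinuousRep G ℤ (coindModule σ) where
  toRepresentation := (coind (subgroupIncl S) σ.toContRepresentation).toRepresentation
  continuous_smul := by
    haveI : DiscreteTopology C(G, A) := discreteTopology_continuousMap G A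
    refine continuous_prod_of_discrete_right.2 fun f => ?_
    refine Continuous.subtype_mk ?_ _
    refine ContinuousMap.continuous_of_continuous_uncurry _ ?_
    exact (f : C(G, A)).continuous.comp (continuous_snd.mul continuous_fst)

variable [CompactSpace G] [DiscreteTopology A]

/-- Unfolding: `(g a*)(x) = a*(x g)`. [cite: SerreGaloisCohomology1997, I §2.5] -/
@[simp] theorem coindRep_apply_apply (g x : G) (f : coindModule σ) :
    ((coindRep σ g f : coindModule σ) : C(G, A)) x = (f : C(G, A)) (x * g) := rfl

/-- The Mathlib continuous representation underlying `coindRep σ` is `ContRepresentation.coind`.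
[folklore] -/
theorem toContRepresentation_coindRep :
    (coindRep σ).toContRepresentation = coind (subgroupIncl S) σ.toContRepresentation :=
  DFunLike.ext _ _ fun _ => rfl

/-- **"Valeur au point `1`"**: the continuous `S`-equivariant map `M_G^S(A) → A`, `a* ↦ a*(1)`,
compatible with the inclusion `S ↪ G` (a morphism `res (S ↪ G) M_G^S(A) ⟶ A` of topological
`S`-modules); it induces the maps `H^q(G, M_G^S(A)) → H^q(S, A)` of Serre I §2.5 (Prop. 10).
[cite: SerreGaloisCohomology1997, I §2.5] -/
def coindEvalOne : TopRep.res (subgroupIncl S : S →* G) (coindRep σ).toTopRep ⟶ σ.toTopRep :=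
  TopRep.ofHom
    { toLinearMap :=
        { toFun := fun f => (f : C(G, A)) 1
          map_add' := fun _ _ => rfl
          map_smul' := fun _ _ => rfl }
      cont := (continuous_eval_const (1 : G)).comp continuous_subtype_val
      isIntertwining' := fun s => by
        ext f
        change ((f : coindModule σ) : C(G, A)) (1 * (s : G)) =
          σ s (((f : coindModule σ) : C(G, A)) 1)
        rw [one_mul, ← (mem_coind_iff σ _).1 f.2 s 1, mul_one] }

/-- Unfolding lemma for `coindEvalOne`. [folklore] -/
@[simp] theorem coindEvalOne_apply (f : coindModule σ) :
    (coindEvalOne σ).hom f = (f : C(G, A)) 1 := rfl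

end Coind

end Literature.NumberTheory.GaloisRepresentations

end
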